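import Summits.MatrixMultiplication.OmegaCensus.SmallFormats.MatMulM22ManyRankOne
import HarnessLib

/-!
# ω-census family (a): the RANK-ONE FLATTENING BOUND — cheap output functionals cost rank-one X-forms: `2·dim Θ ≤ σ` (any field)

Cell `pub-omega` (unit `pub-omega-tensor`, gen 38), topic `Summits/MatrixMultiplication/OmegaCensus` (sub-folder
`SmallFormats`). Framing (verbatim): lottery ticket; floor = certified bounds/negative ranges. HONEST FRAMING: a structural lemma about
bilinear algorithms for `⟨m,2,2⟩` (≅ `⟨2,2,m⟩`) over an ARBITRARY field (fact (F1) of tensor g38's memo LAW-3M3 §6); NOT a bound on any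
rank by itself; nothing here is a bound on `ω`.

## Statement (dictionary of `Literature/…/MatMulM22RankLowerBoundProofs.lean`; `G_t` = coefficient matrix of `g_t`, rows `(p_t j, q_t j)`)

Let `xy = ∑_t f_t(x) g_t(y) w_t` compute `⟨m,2,2⟩` and let `Θ` be a space of OUTPUT FUNCTIONALS `θ : k^{m×2} → k` that annihilate the
output coefficient `w_t` of every term whose `G_t` is INVERTIBLE (`p_t 0 · q_t 1 ≠ p_t 1 · q_t 0`) — i.e. every `θ ∈ Θ` is "computed by
rank-one terms only". Then (`two_mul_finrank_le_card_rankOne`)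

  `2 · dim Θ ≤ σ := #{t : G_t singular}`.

Proof (a flattening of the `4`-slot tensor obtained by splitting `y`'s two indices): the map `(θ₀, θ₁) ↦ [x ↦ (c ↦ θ₀(x E_{0c}) + θ₁(x E_{1c}))]`
from `Θ × Θ` to `Hom(k^{m×2}, k²)` is injective (test on matrix units), and by the scheme identity `θ(x E_{jc}) = ∑_t θ(w_t) f_t(x) G_t[j][c]`
its image lies in the span of ONE element `f_t ⊗ (row of G_t)` per singular `G_t` (the two rows are proportional). With `Θ = ` everything
(no invertible `G_t`) this is the census 'rank row' `2·#inv + #rk1 ≥ 4m`; with the cheap functionals of p719966 (`(★)`) and p720259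
(`θ_c`) it bounds the number of rank-one X-forms from below (LAW-3M3 §6 pattern table). Desk check `f1probe.py`: equality on all tree schemes.
-/

namespace Summit.MatrixMultiplication.OmegaCensus.SmallFormats

open Finset Module
open Literature.Computability.AlgebraicComplexity
open Literature.Computability.AlgebraicComplexity.Alekseev2015

namespace RankOneFlattening

variable {k : Type*} [Field k] {m : ℕ} {ι : Type*} [Fintype ι]

/-- Two vectors of `k²` with vanishing determinant, the first non-zero, are proportional. -/
private theorem exists_smul_of_det {u v : Fin 2 → k} (hu : u ≠ 0) (h : u 0 * v 1 = u 1 * v 0) :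
    ∃ a : k, v = a • u := by
  by_cases h0 : u 0 = 0
  · have h1 : u 1 ≠ 0 := by
      intro h1; apply hu; funext j; fin_cases j <;> simp [h0, h1]
    refine ⟨v 1 / u 1, ?_⟩
    funext j; fin_cases j
    · have : u 1 * v 0 = 0 := by rw [← h, h0, zero_mul]
      have hv0 : v 0 = 0 := by
        rcases mul_eq_zero.1 this with h' | h'
        · exact absurd h' h1
        · exact h'
      simp [hv0, h0]
    · simp [div_mul_cancel₀ _ h1]
  · refine ⟨v 0 / u 0, ?_⟩
    funext j; fin_cases j
    · simp [div_mul_cancel₀ _ h0]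
    · show v 1 = v 0 / u 0 * u 1
      field_simp
      linear_combination h

/-- Row `j` of `G_t`: `(g_t(E_{j0}), g_t(E_{j1})) = (p_t j, q_t j)`. -/
private theorem g_single (β : BilinComp (mulBilin k m 2 2) ι) (t : ι) (j c : Fin 2) :
    β.g t (Matrix.single j c (1 : k)) = (![pvec β t j, qvec β t j] : Fin 2 → k) c := by
  fin_cases c <;> rfl

open scoped Classical in
/-- **The rank-one flattening bound.** If every `θ ∈ Θ` annihilates the output coefficients of all terms with invertible `G_t`, then
`2 · dim Θ ≤ #{t : G_t singular}`. -/
theorem two_mul_finrank_le_card_rankOne (β : BilinComp (mulBilin k m 2 2) ι)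
    (Θ : Submodule k (Module.Dual k (Matrix (Fin m) (Fin 2) k)))
    (hΘ : ∀ θ ∈ Θ, ∀ t, pvec β t 0 * qvec β t 1 ≠ pvec β t 1 * qvec β t 0 → θ (β.w t) = 0) :
    2 * finrank k Θ ≤ (Finset.univ.filter fun t => pvec β t 0 * qvec β t 1 = pvec β t 1 * qvec β t 0).card := by
  classical
  set RO := Finset.univ.filter fun t => pvec β t 0 * qvec β t 1 = pvec β t 1 * qvec β t 0 with hRO
  -- row j of G_t as a vector, and the scheme identity θ(x E_{jc}) = ∑_t θ(w_t) f_t(x) G_t[j][c]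
  let ρ : ι → Fin 2 → (Fin 2 → k) := fun t j => ![pvec β t j, qvec β t j]
  have hscheme : ∀ (θ : Module.Dual k (Matrix (Fin m) (Fin 2) k)) (x : Matrix (Fin m) (Fin 2) k) (j c : Fin 2),
      θ (x * Matrix.single j c (1 : k)) = ∑ t, θ (β.w t) * (β.f t x * ρ t j c) := by
    intro θ x j c
    have h := β.map_eq_sum x (Matrix.single j c (1 : k))
    rw [mulBilin_apply] at h
    rw [h, map_sum]
    refine Finset.sum_congr rfl fun t _ => ?_
    rw [map_smul, smul_eq_mul, g_single]
    ring
  -- ambient space: plain functions x ↦ (c ↦ ·) (a product of copies of k; avoids instance-path issues of `Blk`)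
  -- L_{j,θ} : x ↦ (c ↦ θ(x E_{jc}))
  let L : Fin 2 → Module.Dual k (Matrix (Fin m) (Fin 2) k) → (Matrix (Fin m) (Fin 2) k → Fin 2 → k) :=
    fun j θ x c => θ (x * Matrix.single j c (1 : k))
  -- φ_{t,j} : x ↦ f_t(x) · (row j of G_t)
  let φ : ι → Fin 2 → (Matrix (Fin m) (Fin 2) k → Fin 2 → k) := fun t j x c => β.f t x * ρ t j c
  have hL : ∀ j θ, θ ∈ Θ → L j θ = ∑ t ∈ RO, θ (β.w t) • φ t j := by
    intro j θ hθ
    funext x c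
    simp only [L, φ, Finset.sum_apply, Pi.smul_apply, smul_eq_mul]
    rw [hscheme θ x j c, ← Finset.sum_subset (Finset.subset_univ RO)]
    · intro t _ ht
      have hinv : pvec β t 0 * qvec β t 1 ≠ pvec β t 1 * qvec β t 0 := by
        intro h; exact ht (Finset.mem_filter.2 ⟨Finset.mem_univ _, h⟩)
      rw [hΘ θ hθ t hinv, zero_mul]
  -- one generator per singular t
  let γ : ι → (Matrix (Fin m) (Fin 2) k → Fin 2 → k) := fun t => if ρ t 0 ≠ 0 then φ t 0 else φ t 1
  have hγ : ∀ t ∈ RO, ∀ j, ∃ a : k, φ t j = a • γ t := by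
    intro t ht j
    have hdet : pvec β t 0 * qvec β t 1 = pvec β t 1 * qvec β t 0 := (Finset.mem_filter.1 ht).2
    by_cases h0 : ρ t 0 ≠ 0
    · have hγt : γ t = φ t 0 := if_pos h0
      rw [hγt]
      rcases (show j = 0 ∨ j = 1 by fin_cases j <;> simp) with rfl | rfl
      · exact ⟨1, by rw [one_smul]⟩
      · have hd : ρ t 0 0 * ρ t 1 1 = ρ t 0 1 * ρ t 1 0 := by
          show pvec β t 0 * qvec β t 1 = qvec β t 0 * pvec β t 1
          rw [hdet, mul_comm]
        obtain ⟨a, ha⟩ := exists_smul_of_det h0 hd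
        refine ⟨a, ?_⟩
        funext x c
        simp only [φ, Pi.smul_apply, smul_eq_mul]
        rw [ha, Pi.smul_apply, smul_eq_mul]
        ring
    · have hγt : γ t = φ t 1 := if_neg h0
      rw [hγt]
      rcases (show j = 0 ∨ j = 1 by fin_cases j <;> simp) with rfl | rfl
      · refine ⟨0, ?_⟩
        have h00 : ρ t 0 = 0 := not_not.1 h0
        funext x c
        simp only [φ, Pi.smul_apply, smul_eq_mul]
        rw [h00, Pi.zero_apply, mul_zero, zero_mul]
      · exact ⟨1, by rw [one_smul]⟩
  let T : Submodule k (Matrix (Fin m) (Fin 2) k → Fin 2 → k) := Submodule.span k (↑(RO.image γ) : Set _)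
  have hLT : ∀ j θ, θ ∈ Θ → L j θ ∈ T := by
    intro j θ hθ
    rw [hL j θ hθ]
    refine Submodule.sum_mem _ fun t ht => Submodule.smul_mem _ _ ?_
    obtain ⟨a, ha⟩ := hγ t ht j
    rw [ha]
    exact Submodule.smul_mem _ _ (Submodule.subset_span (by rw [Finset.coe_image]; exact ⟨t, ht, rfl⟩))
  -- the injective map Θ × Θ → T
  let Ψ : (↥Θ × ↥Θ) →ₗ[k] (Matrix (Fin m) (Fin 2) k → Fin 2 → k) :=
    { toFun := fun θθ => L 0 (θθ.1 : Module.Dual k (Matrix (Fin m) (Fin 2) k)) + L 1 (θθ.2 : Module.Dual k (Matrix (Fin m) (Fin 2) k))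
      map_add' := fun a b => by
        funext x c
        simp only [L, Prod.fst_add, Prod.snd_add, Submodule.coe_add, LinearMap.add_apply, Pi.add_apply]
        ring
      map_smul' := fun a b => by
        funext x c
        simp only [L, Prod.smul_fst, Prod.smul_snd, Submodule.coe_smul, LinearMap.smul_apply, Pi.add_apply, Pi.smul_apply,
          smul_eq_mul, RingHom.id_apply]
        ring }
  have hunits : ∀ (θ : Module.Dual k (Matrix (Fin m) (Fin 2) k)),
      (∀ i c, θ (Matrix.single i c (1 : k)) = 0) → θ = 0 := by
    intro θ h
    apply LinearMap.ext; intro x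
    rw [Matrix.matrix_eq_sum_single x, map_sum, LinearMap.zero_apply]
    refine Finset.sum_eq_zero fun i _ => ?_
    rw [map_sum]
    refine Finset.sum_eq_zero fun c _ => ?_
    rw [show Matrix.single i c (x i c) = x i c • Matrix.single i c (1 : k) by
      rw [Matrix.smul_single, smul_eq_mul, mul_one], map_smul, h i c, smul_zero]
  have hΨinj : Function.Injective Ψ := by
    intro a b hab
    have h' : ∀ (x : Matrix (Fin m) (Fin 2) k) (c : Fin 2),
        (a.1 : Module.Dual k (Matrix (Fin m) (Fin 2) k)) (x * Matrix.single (0 : Fin 2) c (1 : k)) +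
        (a.2 : Module.Dual k (Matrix (Fin m) (Fin 2) k)) (x * Matrix.single (1 : Fin 2) c (1 : k)) =
        (b.1 : Module.Dual k (Matrix (Fin m) (Fin 2) k)) (x * Matrix.single (0 : Fin 2) c (1 : k)) +
        (b.2 : Module.Dual k (Matrix (Fin m) (Fin 2) k)) (x * Matrix.single (1 : Fin 2) c (1 : k)) := by
      intro x c
      exact congrFun (congrFun hab x) c
    have h1 : ((a.1 : Module.Dual k (Matrix (Fin m) (Fin 2) k)) - b.1) = 0 := by
      refine hunits _ fun i c => ?_
      have := h' (Matrix.single i (0 : Fin 2) (1 : k)) c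
      rw [Matrix.single_mul_single_same, Matrix.single_mul_single_of_ne (h := (by decide : (0 : Fin 2) ≠ 1)),
        map_zero, map_zero, add_zero, add_zero, mul_one] at this
      rw [LinearMap.sub_apply, this, sub_self]
    have h2 : ((a.2 : Module.Dual k (Matrix (Fin m) (Fin 2) k)) - b.2) = 0 := by
      refine hunits _ fun i c => ?_
      have := h' (Matrix.single i (1 : Fin 2) (1 : k)) c
      rw [Matrix.single_mul_single_same, Matrix.single_mul_single_of_ne (h := (by decide : (1 : Fin 2) ≠ 0)),
        map_zero, map_zero, zero_add, zero_add, mul_one] at this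
      rw [LinearMap.sub_apply, this, sub_self]
    exact Prod.ext (Subtype.ext (sub_eq_zero.1 h1)) (Subtype.ext (sub_eq_zero.1 h2))
  have hΨrange : LinearMap.range Ψ ≤ T := by
    rintro _ ⟨θθ, rfl⟩
    exact Submodule.add_mem _ (hLT 0 _ θθ.1.2) (hLT 1 _ θθ.2.2)
  haveI : Module.Free k ↥Θ := Module.Free.of_divisionRing k ↥Θ
  have h1 : finrank k (↥Θ × ↥Θ) = finrank k (LinearMap.range Ψ) := (LinearMap.finrank_range_of_inj hΨinj).symm
  have h2 := Submodule.finrank_mono hΨrange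
  have h3 : finrank k T ≤ RO.card :=
    (finrank_span_finset_le_card (R := k) (RO.image γ)).trans Finset.card_image_le
  rw [Module.finrank_prod] at h1
  omega

end RankOneFlattening

end Summit.MatrixMultiplication.OmegaCensus.SmallFormats
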